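import Literature.AlgebraicGeometry.ComplexMultiplication.EndomorphismFieldSignatureCondition
import Mathlib.Algebra.MvPolynomial.CommRing
import HarnessLib

/-!
# Howard's `Φ`-determinant condition and Kottwitz's determinant condition on Shimura's pair:
# `det(T₁x₁ + ⋯ + T_r x_r | 𝔪_e/𝔪_e²) = ∏_{φ ∈ Φ} (T₁φ(x₁) + ⋯ + T_r φ(x_r))` in `ℂ[T₁, …, T_r]`, for every basis

Topic `Literature/AlgebraicGeometry/ComplexMultiplication` (family `hodge`, lane `lit-hodgefound`; the ALGEBRAIC
carrier `Motives.AbelianVariety ℂ`, Shimura's pairs `(A, ι : F →+* A.endAlgebra)`, `[F : ℚ] = 2 dim A`, THE type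
`Φ = cmTypeOfPair ι hF`).  Sequel of `EndomorphismFieldCotangentEigenforms` (the eigenbasis `ω_φ` of
`𝔇₀(A) = 𝔪_e/𝔪_e²`, `δι(α) ω_φ = φ(α) ω_φ`) and of `EndomorphismFieldSignatureCondition` (p11 g26-#3: the
ONE-variable determinant condition `char(δu) = ∏_{φ ∈ Φ} (X − φ(α))` and its `K₀`-form `(X − ψ(a))^r (X − ψ̄(a))^s`).
Here are the MULTI-variable determinant conditions AS PRINTED, as identities of multivariate polynomials over `ℂ`
and for EVERY basis of the cotangent space (the determinant is basis-free).

PRINTED STATEMENTS.  B. Howard, *Complex multiplication cycles and Kudla–Rapoport divisors*, Ann. of Math. 176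
(2012) [Howard2012], Def. 3.1.1 and the following paragraph (held text `paper:arxiv-1303.0545` p. 19): «The
`Φ`-determinant condition, introduced by Kottwitz [Ko], is the following: locally on `S`, for any `x₁, …, x_r ∈ 𝒪_K`
the determinant of `T₁x₁ + ⋯ + T_r x_r` acting on `Lie(A)` is equal to the image of
`∏_{φ ∈ Φ} (T₁φ(x₁) + ⋯ + T_r φ(x_r)) ∈ 𝒪_Φ[T₁, …, T_r]` in `𝒪_S[T₁, …, T_r]`.  Note that this condition implies
that every `x ∈ 𝒪_K` acts on `Lie(A)` with characteristic polynomial `∏_{φ ∈ Φ} (T − φ(x))`, and in particular, the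
action of `𝒪_{K₀}` on `A` satisfies the signature `(n − 1, 1)`-condition.»  R. Kottwitz, *Points on some Shimura
varieties over finite fields*, JAMS 5 (1992) [Kottwitz1992], §5 p. 390 (held text `paper:doi-10-2307-2152772`
p. 18): «Let `α₁, …, α_t ; X₁, …, X_t` be as before. Then the determinant of the `𝒪_S`-linear endomorphism
`X₁α₁ + ⋯ + X_tα_t` of `Lie(A)` is a homogeneous polynomial `g(X₁, …, X_t)` of degree `dim_S(A)` … this equality
`g = f` is what we mean by the determinant condition … `det_V = det(X₁α₁ + ⋯ + X_tα_t ; V ⊗_k k[X₁, …, X_t])`.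
Then `V` is isomorphic to `W` if and only if `det_V = det_W`.»  G. Shimura [Shimura1998] §5.2 p. 39 («`δι(α)ωᵢ =
α^{φᵢ}ωᵢ`»: `δι(α)` is `diag(α^{φ₁}, …, α^{φₙ})` on the `ωᵢ`).

WHAT IS PROVED (hypotheses `(ιF : F →+* A.endAlgebra) (hF : finrank ℚ F = 2 * A.dim)`; a family `x : ι → F` with
lifts `u : ι → End A`, `1 ⊗ u i = ι(x i)`; `c` ANY basis of `𝔪_e/𝔪_e²` indexed by a finite type `n`; the determinant
polynomial is `det (∑ i, X i • (toMatrix c c δ(u i)).map C) ∈ MvPolynomial ι ℂ`; over `ℂ` the cotangent space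
`𝔇₀(A)` is the dual of `Lie(A)` with the transposed action — same determinant):

* §1 **`exists_basis_toMatrix_cotangentMap_eq_diagonal`** — an eigenbasis indexed by `Φ` in which every `δu`,
  `1 ⊗ u = ι(α)`, has matrix `diag(φ(α))_{φ ∈ Φ}` (Shimura §5.2).
* §2 `det_sum_X_smul_map_eq_of_mul_eq_one` (private linear algebra: the determinant polynomial of a family of
  matrices is invariant under a change of basis).
* §3 **`det_sum_X_smul_toMatrix_cotangentMap_eq_prod`** — THE `Φ`-DETERMINANT CONDITION / KOTTWITZ'S DETERMINANT
  CONDITION FOR `B = F`: `det(∑ Tᵢ xᵢ | 𝔪_e/𝔪_e²) = ∏_{φ ∈ Φ} (∑ Tᵢ φ(xᵢ))` for every finite family in `ι(F) ∩ End`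
  and every basis.
* §4 **`det_sum_X_smul_toMatrix_cotangentMap_eq_prod_pow`** — the form over a subfield `K₀ ⊆ F`:
  `∏_{ψ : K₀ → ℂ} (∑ Tᵢ ψ(xᵢ))^{m_ψ}` with the multiplicities `m_ψ = #{φ ∈ Φ : φ|_{K₀} = ψ}` (Kottwitz's `det_V` for the
  `K₀ ⊗ ℂ`-module `𝔇₀(A)`); **`det_sum_X_smul_toMatrix_cotangentMap_eq_pow_mul_pow`** — `K₀` imaginary quadratic:
  `(∑ Tᵢ ψ(xᵢ))^{m_ψ} (∑ Tᵢ ψ̄(xᵢ))^{m_ψ̄}`; **`det_sum_X_smul_toMatrix_cotangentMap_eq_of_charpoly_eq`** — under the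
  ONE-variable `(r, s)`-signature condition the multivariable determinant condition of signature `(r, s)` holds
  (and conversely `forall_charpoly_eq_of_forall_det_eq`: the one-element families recover the characteristic polynomials,
  evaluated form `charpoly_eq_of_det_sum_eq` omitted — see `EndomorphismFieldSignatureCondition`).

Theorems only; no definition, no named fact, no `sorry` (net debt 0); axioms `propext`, `Classical.choice`,
`Quot.sound`.

## References
* [Howard2012] B. Howard, *Complex multiplication cycles and Kudla–Rapoport divisors*, Ann. of Math. (2) 176 (2012),
  Def. 3.1.1 and §3.1 (the `Φ`-determinant condition), §1.
* [Kottwitz1992] R. E. Kottwitz, *Points on some Shimura varieties over finite fields*, J. Amer. Math. Soc. 5 (1992),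
  §5, pp. 389–390 (the determinant condition).
* [Shimura1998] G. Shimura, *Abelian Varieties with Complex Multiplication and Modular Functions* (1998), §5.2 p. 39,
  §8.4 (1).
* [KudlaRapoport2013] S. Kudla, M. Rapoport, J. reine angew. Math. 697 (2014), §2.1 (2.1).

## Provenance

Lane `lit-hodgefound` (HOME `run/shared/lean/pub/lit-hodgefound/`), prover seat `lit-hodgefound-p11` (gen 26),
self-proposed row g26-#10 (INBOX claim 2026-08-27).
-/

noncomputable section

namespace Literature.AlgebraicGeometry.ComplexMultiplication

open scoped Manifold Classical nonZeroDivisors Polynomial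
open CategoryTheory NumberField Module
open Literature.AlgebraicGeometry.Motives
open Literature.AlgebraicGeometry.HodgeTheory
open Literature.NumberTheory.ComplexMultiplication

namespace EndFieldFullDegree

variable {F : Type} [Field F] [NumberField F] {A : AbelianVariety ℂ}
  (ιF : F →+* A.endAlgebra) (hF : finrank ℚ F = 2 * A.dim) (K₀ : IntermediateField ℚ F)

/-! ### §1 `δι(α)` is `diag(α^{φ₁}, …, α^{φₙ})` on the eigenbasis -/

/-- **«`δι(α)ωᵢ = α^{φᵢ}ωᵢ`»**: there is a basis of `𝔪_e/𝔪_e²` indexed by THE type `Φ = cmTypeOfPair ι hF` in which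
every `δu` with `1 ⊗ u = ι(α)` has the DIAGONAL matrix `diag(φ(α))_{φ ∈ Φ}`. [cite: Shimura1998, §5.2, p. 39] -/
theorem exists_basis_toMatrix_cotangentMap_eq_diagonal :
    ∃ b : Basis (cmTypeOfPair ιF hF).1 ℂ (Motives.AbelianVariety.Cotangent A),
      ∀ (α : F) (u : End A), AbelianVariety.endAlgebra.of A u = ιF α →
        LinearMap.toMatrix b b (Motives.AbelianVariety.cotangentMap A u) =
          Matrix.diagonal fun σ : (cmTypeOfPair ιF hF).1 => (σ.1 α : ℂ) := by
  obtain ⟨b, hb⟩ := exists_basis_eigenforms ιF hF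
  refine ⟨b, fun α u hu => ?_⟩
  ext i j
  rw [LinearMap.toMatrix_apply, hb j α u hu, map_smul, Finsupp.smul_apply, b.repr_self,
    Matrix.diagonal_apply, Finsupp.single_apply, smul_eq_mul, mul_ite, mul_one, mul_zero]
  by_cases h : i = j
  · subst h
    simp
  · rw [if_neg (Ne.symm h), if_neg h]

/-- The same for the eigenbasis REINDEXED along any bijection `e : n ≃ Φ` (to compare with an arbitrary basis
indexed by `n`). [cite: Shimura1998, §5.2, p. 39] -/
theorem exists_basis_toMatrix_cotangentMap_eq_diagonal_reindex {n : Type} [Fintype n] [DecidableEq n]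
    (e : n ≃ (cmTypeOfPair ιF hF).1) :
    ∃ b : Basis n ℂ (Motives.AbelianVariety.Cotangent A),
      ∀ (α : F) (u : End A), AbelianVariety.endAlgebra.of A u = ιF α →
        LinearMap.toMatrix b b (Motives.AbelianVariety.cotangentMap A u) =
          Matrix.diagonal fun k : n => ((e k).1 α : ℂ) := by
  obtain ⟨b, hb⟩ := exists_basis_eigenforms ιF hF
  refine ⟨b.reindex e.symm, fun α u hu => ?_⟩
  have hb' : ∀ k : n, Motives.AbelianVariety.cotangentMap A u (b.reindex e.symm k) =
      ((e k).1 α : ℂ) • b.reindex e.symm k := fun k => by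
    rw [Basis.reindex_apply, Equiv.symm_symm]
    exact hb (e k) α u hu
  ext i j
  rw [LinearMap.toMatrix_apply, hb' j, map_smul, Finsupp.smul_apply, (b.reindex e.symm).repr_self,
    Matrix.diagonal_apply, Finsupp.single_apply, smul_eq_mul, mul_ite, mul_one, mul_zero]
  by_cases h : i = j
  · subst h
    simp
  · rw [if_neg (Ne.symm h), if_neg h]

/-! ### §2 The determinant polynomial of a family of endomorphisms is basis-free -/

/-- Change of basis inside the determinant polynomial: for `P Q` with `P * Q = 1`,
`det (∑ i, X i • (P * M i * Q).map C) = det (∑ i, X i • (M i).map C)` in `MvPolynomial ι ℂ`. [folklore] -/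
private theorem det_sum_X_smul_map_eq_of_mul_eq_one {n : Type} [Fintype n] [DecidableEq n] {ι : Type} [Fintype ι]
    (P Q : Matrix n n ℂ) (hPQ : P * Q = 1) (M : ι → Matrix n n ℂ) :
    (∑ i, (MvPolynomial.X i : MvPolynomial ι ℂ) •
        ((P * M i * Q).map MvPolynomial.C : Matrix n n (MvPolynomial ι ℂ))).det =
      (∑ i, (MvPolynomial.X i : MvPolynomial ι ℂ) •
        ((M i).map MvPolynomial.C : Matrix n n (MvPolynomial ι ℂ))).det := by
  set P' : Matrix n n (MvPolynomial ι ℂ) := P.map MvPolynomial.C with hP'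
  set Q' : Matrix n n (MvPolynomial ι ℂ) := Q.map MvPolynomial.C with hQ'
  have hmul : ∀ i, (MvPolynomial.X i : MvPolynomial ι ℂ) •
      ((P * M i * Q).map MvPolynomial.C : Matrix n n (MvPolynomial ι ℂ)) =
      P' * ((MvPolynomial.X i : MvPolynomial ι ℂ) • ((M i).map MvPolynomial.C : Matrix n n (MvPolynomial ι ℂ))) *
        Q' := by
    intro i
    rw [Matrix.map_mul, Matrix.map_mul, Matrix.mul_smul, Matrix.smul_mul]
  have hsum : ∑ i, (MvPolynomial.X i : MvPolynomial ι ℂ) •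
      ((P * M i * Q).map MvPolynomial.C : Matrix n n (MvPolynomial ι ℂ)) =
      P' * (∑ i, (MvPolynomial.X i : MvPolynomial ι ℂ) •
        ((M i).map MvPolynomial.C : Matrix n n (MvPolynomial ι ℂ))) * Q' := by
    rw [Finset.mul_sum, Finset.sum_mul]
    exact Finset.sum_congr rfl fun i _ => hmul i
  have hdet : P'.det * Q'.det = 1 := by
    rw [hP', hQ', ← Matrix.det_mul, ← Matrix.map_mul, hPQ]
    have h1 : ((1 : Matrix n n ℂ).map MvPolynomial.C : Matrix n n (MvPolynomial ι ℂ)) = 1 := by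
      ext i j
      rw [Matrix.map_apply, Matrix.one_apply, Matrix.one_apply]
      split_ifs <;> simp
    rw [h1, Matrix.det_one]
  rw [hsum, Matrix.det_mul, Matrix.det_mul]
  linear_combination (∑ i, (MvPolynomial.X i : MvPolynomial ι ℂ) •
    ((M i).map MvPolynomial.C : Matrix n n (MvPolynomial ι ℂ))).det * hdet

/-- The determinant polynomial of a family of DIAGONAL matrices. [folklore] -/
private theorem det_sum_X_smul_map_diagonal {n : Type} [Fintype n] [DecidableEq n] {ι : Type} [Fintype ι]
    (d : ι → n → ℂ) :
    (∑ i, (MvPolynomial.X i : MvPolynomial ι ℂ) •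
        ((Matrix.diagonal (d i)).map MvPolynomial.C : Matrix n n (MvPolynomial ι ℂ))).det =
      ∏ k : n, ∑ i, MvPolynomial.X i * MvPolynomial.C (d i k) := by
  have hdiag : ∑ i, (MvPolynomial.X i : MvPolynomial ι ℂ) •
      ((Matrix.diagonal (d i)).map MvPolynomial.C : Matrix n n (MvPolynomial ι ℂ)) =
      Matrix.diagonal fun k : n => ∑ i, MvPolynomial.X i * MvPolynomial.C (d i k) := by
    ext k l
    simp only [Matrix.sum_apply, Matrix.smul_apply, Matrix.map_apply, Matrix.diagonal_apply]
    split_ifs with h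
    · simp [smul_eq_mul]
    · simp
  rw [hdiag, Matrix.det_diagonal]

/-! ### §3 The `Φ`-determinant condition on Shimura's pair -/

/-- **HOWARD'S `Φ`-DETERMINANT CONDITION = KOTTWITZ'S DETERMINANT CONDITION (for `B = F`) HOLDS ON SHIMURA'S PAIR**:
for every finite family `x : ι → F` with lifts `u i ∈ End(A)`, `1 ⊗ u i = ι(x i)`, and EVERY basis `c` of
`𝔇₀(A) = 𝔪_e/𝔪_e²`, the determinant of `∑ᵢ Tᵢ · [δ(u i)]_c` in `ℂ[Tᵢ : i ∈ ι]` is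
`∏_{φ ∈ Φ} (∑ᵢ Tᵢ φ(xᵢ))` («the determinant of `T₁x₁ + ⋯ + T_r x_r` acting on `Lie(A)` is equal to the image of
`∏_{φ ∈ Φ}(T₁φ(x₁) + ⋯ + T_rφ(x_r))`»; «`det_V = det(X₁α₁ + ⋯ + X_tα_t ; V ⊗_k k[X₁, …, X_t])`»).
[cite: Howard2012, Def. 3.1.1 and §3.1] [cite: Kottwitz1992, §5 (pp. 389–390)] [cite: Shimura1998, §5.2, p. 39] -/
theorem det_sum_X_smul_toMatrix_cotangentMap_eq_prod {ι : Type} [Fintype ι] {x : ι → F} {u : ι → End A}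
    (hu : ∀ i, AbelianVariety.endAlgebra.of A (u i) = ιF (x i)) {n : Type} [Fintype n] [DecidableEq n]
    (c : Basis n ℂ (Motives.AbelianVariety.Cotangent A)) :
    (∑ i, (MvPolynomial.X i : MvPolynomial ι ℂ) •
        ((LinearMap.toMatrix c c (Motives.AbelianVariety.cotangentMap A (u i))).map MvPolynomial.C :
          Matrix n n (MvPolynomial ι ℂ))).det =
      ∏ σ : (cmTypeOfPair ιF hF).1, ∑ i, MvPolynomial.X i * MvPolynomial.C (σ.1 (x i) : ℂ) := by
  obtain ⟨b₀, -⟩ := exists_basis_eigenforms ιF hF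
  let e : n ≃ (cmTypeOfPair ιF hF).1 := c.indexEquiv b₀
  obtain ⟨b, hb⟩ := exists_basis_toMatrix_cotangentMap_eq_diagonal_reindex ιF hF e
  have hconj : ∀ i, LinearMap.toMatrix c c (Motives.AbelianVariety.cotangentMap A (u i)) =
      c.toMatrix b * Matrix.diagonal (fun k : n => ((e k).1 (x i) : ℂ)) * b.toMatrix c := fun i => by
    rw [← hb (x i) (u i) (hu i), basis_toMatrix_mul_linearMap_toMatrix_mul_basis_toMatrix]
  simp_rw [hconj]
  rw [det_sum_X_smul_map_eq_of_mul_eq_one (c.toMatrix b) (b.toMatrix c) (c.toMatrix_mul_toMatrix_flip b) _,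
    det_sum_X_smul_map_diagonal]
  exact Fintype.prod_equiv e _ _ fun k => rfl

/-! ### §4 The form over a subfield `K₀ ⊆ F`: multiplicities as exponents -/

/-- **Kottwitz's `det_V` for the `K₀ ⊗ ℂ`-module `𝔇₀(A)`**: for a family `x : ι → K₀` (lifts `u i`, any basis `c`),
`det(∑ᵢ Tᵢ · [δ(u i)]_c) = ∏_{ψ : K₀ → ℂ} (∑ᵢ Tᵢ ψ(xᵢ))^{m_ψ}` with `m_ψ = #{φ ∈ Φ : φ|_{K₀} = ψ}` — the
isomorphism class of the `K₀ ⊗ ℂ`-module («`V` is isomorphic to `W` if and only if `det_V = det_W`») is the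
signature. [cite: Kottwitz1992, §5 (pp. 389–390)] [cite: Howard2012, Def. 3.1.1 and §1] -/
theorem det_sum_X_smul_toMatrix_cotangentMap_eq_prod_pow {ι : Type} [Fintype ι] {x : ι → K₀} {u : ι → End A}
    (hu : ∀ i, AbelianVariety.endAlgebra.of A (u i) = ιF (algebraMap K₀ F (x i))) {n : Type} [Fintype n]
    [DecidableEq n] (c : Basis n ℂ (Motives.AbelianVariety.Cotangent A)) :
    (∑ i, (MvPolynomial.X i : MvPolynomial ι ℂ) •
        ((LinearMap.toMatrix c c (Motives.AbelianVariety.cotangentMap A (u i))).map MvPolynomial.C :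
          Matrix n n (MvPolynomial ι ℂ))).det =
      ∏ ψ : K₀ →+* ℂ, (∑ i, MvPolynomial.X i * MvPolynomial.C (ψ (x i) : ℂ)) ^
        Fintype.card {σ : (cmTypeOfPair ιF hF).1 // σ.1.comp (algebraMap K₀ F) = ψ} := by
  rw [det_sum_X_smul_toMatrix_cotangentMap_eq_prod ιF hF hu c]
  have h := Fintype.prod_fiberwise' (fun σ : (cmTypeOfPair ιF hF).1 ↦ σ.1.comp (algebraMap K₀ F))
    (fun ψ : K₀ →+* ℂ ↦ ∑ i, (MvPolynomial.X i : MvPolynomial ι ℂ) * MvPolynomial.C (ψ (x i) : ℂ))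
  simp only [RingHom.comp_apply] at h
  rw [← h]
  refine Finset.prod_congr rfl fun ψ _ ↦ ?_
  rw [Finset.prod_const, Finset.card_univ]

section Quadratic

variable [IsTotallyComplex K₀]

/-- `ψ̄ ≠ ψ`. [folklore] -/
private theorem conjugate_ne₁₀ (ψ : K₀ →+* ℂ) : ComplexEmbedding.conjugate ψ ≠ ψ := fun h =>
  IsTotallyComplex.complexEmbedding_not_isReal ψ (ComplexEmbedding.isReal_iff.2 h)

/-- `Hom(K₀, ℂ) = {ψ, ψ̄}` for `[K₀ : ℚ] = 2`. [cite: Shimura1998, §8.4 (1)] -/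
private theorem univ_eq_pair₁₀ (hK₀ : finrank ℚ K₀ = 2) (ψ : K₀ →+* ℂ) :
    (Finset.univ : Finset (K₀ →+* ℂ)) = {ψ, ComplexEmbedding.conjugate ψ} := by
  ext χ
  simp only [Finset.mem_univ, Finset.mem_insert, Finset.mem_singleton, true_iff]
  by_contra h
  push Not at h
  have h3 := Fintype.two_lt_card_iff.2 ⟨χ, ψ, ComplexEmbedding.conjugate ψ, h.1, h.2, (conjugate_ne₁₀ K₀ ψ).symm⟩
  rw [Embeddings.card, hK₀] at h3
  exact lt_irrefl _ h3

/-- **The determinant condition of signature `(m_ψ, m_ψ̄)` for an imaginary quadratic `K₀`**: for `x : ι → K₀`,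
`det(∑ᵢ Tᵢ · [δ(u i)]_c) = (∑ᵢ Tᵢ ψ(xᵢ))^{m_ψ} · (∑ᵢ Tᵢ ψ̄(xᵢ))^{m_ψ̄}` — Kottwitz's `f(X₁, …, X_t)` for `GU(r, s)`
with `(r, s)` READ ON THE TYPE. [cite: Kottwitz1992, §5 (pp. 389–390)] [cite: Howard2012, §1] [cite: KudlaRapoport2013, §2.1 (2.1)] -/
theorem det_sum_X_smul_toMatrix_cotangentMap_eq_pow_mul_pow (hK₀ : finrank ℚ K₀ = 2) (ψ : K₀ →+* ℂ)
    {ι : Type} [Fintype ι] {x : ι → K₀} {u : ι → End A}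
    (hu : ∀ i, AbelianVariety.endAlgebra.of A (u i) = ιF (algebraMap K₀ F (x i))) {n : Type} [Fintype n]
    [DecidableEq n] (c : Basis n ℂ (Motives.AbelianVariety.Cotangent A)) :
    (∑ i, (MvPolynomial.X i : MvPolynomial ι ℂ) •
        ((LinearMap.toMatrix c c (Motives.AbelianVariety.cotangentMap A (u i))).map MvPolynomial.C :
          Matrix n n (MvPolynomial ι ℂ))).det =
      (∑ i, MvPolynomial.X i * MvPolynomial.C (ψ (x i) : ℂ)) ^
          Fintype.card {σ : (cmTypeOfPair ιF hF).1 // σ.1.comp (algebraMap K₀ F) = ψ} *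
        (∑ i, MvPolynomial.X i * MvPolynomial.C (ComplexEmbedding.conjugate ψ (x i) : ℂ)) ^
          Fintype.card {σ : (cmTypeOfPair ιF hF).1 //
            σ.1.comp (algebraMap K₀ F) = ComplexEmbedding.conjugate ψ} := by
  rw [det_sum_X_smul_toMatrix_cotangentMap_eq_prod_pow ιF hF K₀ hu c, univ_eq_pair₁₀ K₀ hK₀ ψ,
    Finset.prod_pair (conjugate_ne₁₀ K₀ _).symm]

include hF in
/-- **The ONE-variable `(r, s)`-signature condition implies the MULTI-variable determinant condition of signature
`(r, s)`**: if `char(δu) = (X − ψ(a))^r (X − ψ̄(a))^s` for all `a ∈ K₀`, `1 ⊗ u = ι(a)`, then for every family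
`x : ι → K₀` and every basis, `det(∑ᵢ Tᵢ · [δ(u i)]) = (∑ᵢ Tᵢ ψ(xᵢ))^r (∑ᵢ Tᵢ ψ̄(xᵢ))^s` — both record
`(m_ψ, m_ψ̄) = (r, s)`. [cite: Kottwitz1992, §5 (p. 390)] [cite: Howard2012, §1 and Def. 3.1.1] -/
theorem det_sum_X_smul_toMatrix_cotangentMap_eq_of_charpoly_eq (hK₀ : finrank ℚ K₀ = 2) (ψ : K₀ →+* ℂ) {r s : ℕ}
    (h : ∀ (a : K₀) (v : End A), AbelianVariety.endAlgebra.of A v = ιF (algebraMap K₀ F a) →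
      (Motives.AbelianVariety.cotangentMap A v).charpoly =
        (Polynomial.X - Polynomial.C (ψ a : ℂ)) ^ r *
          (Polynomial.X - Polynomial.C (ComplexEmbedding.conjugate ψ a : ℂ)) ^ s)
    {ι : Type} [Fintype ι] {x : ι → K₀} {u : ι → End A}
    (hu : ∀ i, AbelianVariety.endAlgebra.of A (u i) = ιF (algebraMap K₀ F (x i))) {n : Type} [Fintype n]
    [DecidableEq n] (c : Basis n ℂ (Motives.AbelianVariety.Cotangent A)) :
    (∑ i, (MvPolynomial.X i : MvPolynomial ι ℂ) •
        ((LinearMap.toMatrix c c (Motives.AbelianVariety.cotangentMap A (u i))).map MvPolynomial.C :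
          Matrix n n (MvPolynomial ι ℂ))).det =
      (∑ i, MvPolynomial.X i * MvPolynomial.C (ψ (x i) : ℂ)) ^ r *
        (∑ i, MvPolynomial.X i * MvPolynomial.C (ComplexEmbedding.conjugate ψ (x i) : ℂ)) ^ s := by
  obtain ⟨h1, h2⟩ := card_fibre_eq_of_charpoly_eq ιF hF K₀ hK₀ ψ h
  rw [det_sum_X_smul_toMatrix_cotangentMap_eq_pow_mul_pow ιF hF K₀ hK₀ ψ hu c, h1, h2]

end Quadratic

end EndFieldFullDegree

end Literature.AlgebraicGeometry.ComplexMultiplication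

end
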